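/-
Copyright (c) 2026. All rights reserved.
Released under Apache 2.0 license as described in the file LICENSE.
Authors: abc-iut cell, statement-typer seat abc-iut-L4-t3 (wave 1; gen 6); `⋉`-twin re-elaborated by prover seat abc-iut-L4-t11
(gen 15) per the cell recipe LTIMES-RECIPE (owner abc-iut-L4-t3), statements unchanged.
-/
import Literature.AnabelianGeometry.AbsoluteAnabelian.Ltimes.LogFrobeniusObservables
import Literature.AnabelianGeometry.AbsoluteAnabelian.LogFrobeniusIotaOver
import HarnessLib

/-!
# [AbsTopIII] Definition 5.4 (iv)/(vii), interface add-on: the natural transformations `ι⊞_{v,ε}`, `ι_{v,ε}` lie over `Th•[Z]`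

S. Mochizuki, *Topics in absolute anabelian geometry III: global reconstruction algorithms*,
J. Math. Sci. Univ. Tokyo 22 (2015) 939–1156 [MochizukiAbsTopIII2015]; locators `p.N` = pages of the author's
manuscript (`paper:url-5493eb38cbb7`), read on the page (own render): Def 5.4 (ii) p. 125 l. 22–25 / p. 126 l. 2–5
("the construction underlying this functor leaves the underlying … Galois-theater unchanged, i.e., `log•_{T,T}` 'lies
over' `Th•`"), Def 5.4 (iv) p. 127 l. 56–65 ("Thus, in summary, we obtain natural functors `λ⊞_{v,ν} : Th•_T[Z] → 𝒩⊞_v`;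
`λ_{v,ν} : Th•_T[Z] → 𝒩_v` — where the latter functor is obtained by composing the former functor with the natural functor
`𝒩⊞_v → 𝒩_v` — that 'lie over' `Th•[Z]`, for each vertex `ν` of `Γ⃗^log_v`"; (vi) p. 128 l. 73–82 verbatim for `v`
archimedean), Def 5.4 (vii) p. 128 l. 83–101 ("for each edge `ε` of `Γ⃗^⋉_v` (respectively, `Γ⃗^log_v`) running from a
vertex `ν₁` to a vertex `ν₂`, the arrow in the diagram of (iii) (respectively, (v)) corresponding to `ε` determines a
natural transformation `ι⊞_{v,ε} : λ⊞_{v,ν₁} ∘ Λ_{ν₁} → λ⊞_{v,ν₂}` (respectively, `ι_{v,ε} : λ_{v,ν₁} ∘ Λ_{ν₁} → λ_{v,ν₂}`) — where,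
for each pre-log vertex `ν` …, we take `Λ_ν` to be the identity functor on `Th•_T[Z]`; for the post-log vertex `ν` …, we
take `Λ_ν` to be the log-Frobenius functor `log•_{T,T}`").

WHY THIS FILE (interface ADD-ON, successor never in place; the FROZEN `LogFrobeniusCompatibility.lean` /
`LogFrobeniusObservables.lean` of this seat are NOT edited).  In print the `λ⊞_{v,ν}` are functors OVER `Th•[Z]`
(the categories `𝒩⊞_v`, `𝒩_v` are fibred products over `Orb(TG)` resp. `Orb(EA)` with `Th•[Z]`, Def 5.4 (iv)/(vi)), and
`ι⊞_{v,ε}` is "determined by the arrow in the diagram of (iii)" — a natural map between the local data attached to ONE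
and the same `•`-theater; so `ι⊞_{v,ε}`, pushed down along `𝒩⊞_v → 𝒩_v → Th•[Z]`, is the canonical identification of the
underlying theaters: the identity for a pre-log `ν₁` (`Λ_{ν₁} = id`), the isomorphism "`log•_{T,T}` lies over `Th•`" for
the post-log `ν₁` (`Λ_{ν₁} = log`).  The interface `LogFrobeniusSetting` records "lies over `Th•[Z]`" for the FUNCTORS
(`lamOver`, `logOver`) but not for the natural transformations `iota` (nor does the add-on `TSHomotopies` for the
`TS`-valued `ι_{v,ε}`).  abc-iut-f-102 showed in the kernel that this omission is LOAD-BEARING: per place, realising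
Cor 5.5 (i)+(iii) in one family forces every `ι⊞_{v,ε}` to become invertible over `ℰ•`
(`isIso_toE_forget_iota_of_realisesCor55Families`, `LogFrobeniusShiftActionIotaIso.lean`), and ACROSS places a coherence
that no per-place condition captures (`LogFrobeniusCrossPlaceObstruction.lean`: a setting all of whose `ι⊞` are
isomorphisms, `−id` at one archimedean place, at which `RealisesCor55Families`, hence F-0157/F-0156, fail), naming
the missing field "`iotaOver`: `ι⊞ ▹ (forget ⋙ toE) = lamOver ≫ lamOver⁻¹` (twisted by `logOver` at post-log)"
(STATUS 2026-08-26T13:12:28Z).  Here it is, as a print-quoting hypothesis schema on the setting: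

* `twistOver L b` — "`Λ_ν` lies over `Th•[Z]`": `Λ_ν ⋙ proj ≅ proj`, the identity at a pre-log vertex, `logOver` at the
  post-log vertex (Def 5.4 (ii), (vii));
* `IotaOver L` — **the `ι⊞_{v,ε}` lie over `Th•[Z]`**: for every `v`, every admissible edge `ε : ν₁ → ν₂` and every object
  `X₀` of `Th•_T[Z]`, the image of `ι⊞_{v,ε,X₀}` under `𝒩⊞_v → 𝒩_v → Th•[Z]` is the composite of the structure
  isomorphisms `λ_{v,ν₁}(Λ X₀) ↦ proj(Λ X₀) ↦ proj X₀ ↦ λ_{v,ν₂}(X₀)` (`lamOver`, `twistOver`, `lamOver⁻¹`) — stated as ONE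
  equation of natural transformations `ι⊞_{v,ε} ▹ (𝒩⊞_v → 𝒩_v → Th•[Z]) = (λ_{v,ν₁} ∘ Λ_{ν₁} ≅ proj) ≫ (proj ≅ λ_{v,ν₂})`
  (`lamTwistOver`); `IotaOver.app` / `IotaOver.of_app` give the componentwise form;
* `TSHomotopies.IotaOverTS T` — the same for the `TS`-valued `ι_{v,ε}` of the add-on `TSHomotopies` on ALL edges of
  `Γ⃗^log_v`; on the edges of `Γ⃗^⋉_v` it FOLLOWS from `IotaOver` (`TSHomotopies.toE_map_iota_toTS`), the new content
  being the edges of `Γ⃗^log_v ∖ Γ⃗^⋉_v` (nonarchimedean "`↪ k`");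
* consequences: over `Th•[Z]` every `ι⊞_{v,ε}` is an ISOMORPHISM (`IotaOver.isIso_toE_forget_iota`) — so the add-on
  implies abc-iut-f-102's per-place necessary conditions (pre-log and post-log) at once; and any two `ι⊞` with the same
  endpoints agree over `Th•[Z]` (`IotaOver.toE_forget_iota_eq`);
* non-vacuity: at the DIAGONAL setting on any category (every structure functor `𝟭`, every 2-cell an identity,
  `ι⊞ := (Λ ∘ 𝟭 = 𝟭)`; abc-iut-w4-d095 / this seat's `LogFrobeniusSettingNonVacuity.lean` pattern) `IotaOver` holds
  (`exists_iotaOver_of_category`) — a DEGENERATE consistency witness, no arithmetic content.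

An ASSUMPTION-SCHEMA on `L` (a parameterised `Prop`, consumed as a hypothesis at named settings; print's genuine
theaters satisfy it by Def 5.4 (iv)/(vii)), not a fact about every `L`.  Refereed pre-IUT material; nothing here bears
on [IUTchIII] Cor. 3.12; OUR kernel typing, no side taken; typed ≠ proved.

**`⋉`-TWIN (cell row «LTIMES-SUCCESSOR», L4-lead m162; typing finding T3g9-F1).**  This file is the verbatim
re-elaboration of `LogFrobeniusIotaOver.lean` over the successor interface `LogFrobeniusSettingLtimes`
(`Ltimes/LogFrobeniusCompatibility.lean`: `ι⊞_{v,ε}` indexed by the edges of `Γ⃗^⋉_v` at EVERY place, [AbsTopIII] Cor 5.5 (iii)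
p. 131), produced by the cell recipe `LTIMES-RECIPE.md`: names carry over inside `namespace LogFrobeniusSettingLtimes`, the
section variable is `Lt`, setting-independent declarations are NOT repeated (the originals are in scope), statements and
proofs are otherwise unchanged.  The original file over the frozen interface stays as it is.
-/

set_option autoImplicit false

universe u

open CategoryTheory

namespace Literature.AnabelianGeometry.AbsoluteAnabelian

namespace LogFrobeniusSettingLtimes

variable {Vmod : Type u} {isArc : Vmod → Bool} (Lt : LogFrobeniusSettingLtimes Vmod isArc)

-- setting-independent declarations of the original file (namespace `LogFrobeniusSetting`) re-exposed under the
-- successor namespace (recipe rule 5); the originals are imported, not repeated.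
export LogFrobeniusSetting (diagonalTwistIso diagonalTwistIso_false diagonalTwistIso_true)

/-! ## `Λ_ν` lies over `Th•[Z]` -/

/-- **"`Λ_ν` lies over `Th•[Z]`"**: `Λ_ν ⋙ proj ≅ proj` — the identity for a pre-log vertex (`Λ_ν = id`), the isomorphism
"`log•_{T,T}` lies over `Th•`" (`logOver`, Def 5.4 (ii)) for the post-log vertex (`Λ_ν = log•_{T,T}`), as a function of
the Boolean "is `ν` the post-log vertex". [cite: MochizukiAbsTopIII2015, Def 5.4 (vii) p. 128] -/
def twistOver : (b : Bool) → (frobeniusTwist Lt.log b ⋙ Lt.proj ≅ Lt.proj)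
  | false => Lt.proj.leftUnitor
  | true => Lt.logOver

/-- at a pre-log vertex: the identity. [cite: MochizukiAbsTopIII2015, Def 5.4 (vii) p. 128] -/
@[simp] theorem twistOver_false : Lt.twistOver false = Lt.proj.leftUnitor := rfl

/-- at the post-log vertex: `logOver`. [cite: MochizukiAbsTopIII2015, Def 5.4 (ii) p. 125] -/
@[simp] theorem twistOver_true : Lt.twistOver true = Lt.logOver := rfl

/-- "`λ_{v,ν} ∘ Λ_ν` lies over `Th•[Z]`": the source of `ι_{v,ε}` pushed down to `Th•[Z]` is canonically `proj`
(`lamOver` after `twistOver`). [cite: MochizukiAbsTopIII2015, Def 5.4 (iv) p. 127] -/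
def lamTwistOver (v : Vmod) (ν : LogVertex (isArc v)) :
    (frobeniusTwist Lt.log ν.isPostLog ⋙ Lt.lam v ν) ⋙ Lt.forget v ⋙ Lt.toE v ≅ Lt.proj :=
  Functor.associator _ _ _ ≪≫ Functor.isoWhiskerLeft _ (Lt.lamOver v ν) ≪≫ Lt.twistOver ν.isPostLog

/-! ## The `ι⊞_{v,ε}` lie over `Th•[Z]` -/

/-- **INTERFACE ADD-ON (Def 5.4 (iv)/(vii)): the natural transformations `ι⊞_{v,ε}` lie over `Th•[Z]`.**  For every
`v ∈ V(F_mod)` and every edge `ε : ν₁ → ν₂` along which `ι⊞_{v,ε}` is defined: `ι⊞_{v,ε}` pushed down along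
`𝒩⊞_v → 𝒩_v → Th•[Z]` is the composite of the structure isomorphisms "`λ_{v,ν₁} ∘ Λ_{ν₁}` lies over `Th•[Z]`"
(`lamTwistOver` = `lamOver` then `twistOver`) and the inverse of "`λ_{v,ν₂}` lies over `Th•[Z]`" — i.e. `ι⊞_{v,ε}` is a
morphism OVER the identity of the underlying `•`-theater ("the arrow in the diagram of (iii) corresponding to `ε`
determines" it: a map between local data of one theater; at the post-log vertex `Λ = log•_{T,T}` "lies over `Th•`").  The
frozen interface records "lie over `Th•[Z]`" for the functors only; this is the same clause for the `ι⊞`.  A hypothesis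
schema on `L`, satisfied by print's theaters. [cite: MochizukiAbsTopIII2015, Def 5.4 (vii) p. 128] -/
def IotaOver : Prop :=
  ∀ (v : Vmod) ⦃ν₁ ν₂ : LogVertex (isArc v)⦄ (ε : LogEdgeLtimes (isArc v) ν₁ ν₂),
    Functor.whiskerRight (Lt.iota v ε) (Lt.forget v ⋙ Lt.toE v) = (Lt.lamTwistOver v ν₁).hom ≫ (Lt.lamOver v ν₂).inv

namespace IotaOver

variable {Lt}

/-- Componentwise form: for every object `X₀` of `Th•_T[Z]`, the image of `ι⊞_{v,ε,X₀}` under `𝒩⊞_v → 𝒩_v → Th•[Z]` is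
"`λ_{v,ν₁} ∘ Λ_{ν₁}` lies over" at `X₀` followed by "(`λ_{v,ν₂}` lies over)⁻¹" at `X₀`.
[cite: MochizukiAbsTopIII2015, Def 5.4 (vii) p. 128] -/
theorem app (h : Lt.IotaOver) (v : Vmod) {ν₁ ν₂ : LogVertex (isArc v)} (ε : LogEdgeLtimes (isArc v) ν₁ ν₂) (X₀ : Lt.X) :
    (Lt.toE v).map ((Lt.forget v).map ((Lt.iota v ε).app X₀)) =
      (Lt.lamTwistOver v ν₁).hom.app X₀ ≫ (Lt.lamOver v ν₂).inv.app X₀ := by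
  have := NatTrans.congr_app (h v ε) X₀
  rw [Functor.whiskerRight_app, NatTrans.comp_app, Functor.comp_map] at this
  exact this

/-- Conversely, the componentwise equations give the schema. [cite: MochizukiAbsTopIII2015, Def 5.4 (vii) p. 128] -/
theorem of_app
    (h : ∀ (v : Vmod) ⦃ν₁ ν₂ : LogVertex (isArc v)⦄ (ε : LogEdgeLtimes (isArc v) ν₁ ν₂) (X₀ : Lt.X),
      (Lt.toE v).map ((Lt.forget v).map ((Lt.iota v ε).app X₀)) =
        (Lt.lamTwistOver v ν₁).hom.app X₀ ≫ (Lt.lamOver v ν₂).inv.app X₀) :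
    Lt.IotaOver := by
  intro v ν₁ ν₂ ε
  ext X₀
  rw [Functor.whiskerRight_app, NatTrans.comp_app, Functor.comp_map]
  exact h v ε X₀

/-- `ι⊞_{v,ε}` over `Th•[Z]` followed by "`λ_{v,ν₂}` lies over `Th•[Z]`" is "`λ_{v,ν₁} ∘ Λ_{ν₁}` lies over `Th•[Z]`" (a form
convenient for pasting squares). [cite: MochizukiAbsTopIII2015, Def 5.4 (vii) p. 128] -/
theorem whiskerRight_comp_lamOver_hom (h : Lt.IotaOver) (v : Vmod) {ν₁ ν₂ : LogVertex (isArc v)}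
    (ε : LogEdgeLtimes (isArc v) ν₁ ν₂) :
    Functor.whiskerRight (Lt.iota v ε) (Lt.forget v ⋙ Lt.toE v) ≫ (Lt.lamOver v ν₂).hom = (Lt.lamTwistOver v ν₁).hom := by
  rw [h v ε, Category.assoc, Iso.inv_hom_id, Category.comp_id]

/-- With both structure isomorphisms moved to the outside, `ι⊞_{v,ε}` over `Th•[Z]` is the identity of `proj`.
[cite: MochizukiAbsTopIII2015, Def 5.4 (vii) p. 128] -/
theorem lamTwistOver_inv_comp (h : Lt.IotaOver) (v : Vmod) {ν₁ ν₂ : LogVertex (isArc v)}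
    (ε : LogEdgeLtimes (isArc v) ν₁ ν₂) :
    (Lt.lamTwistOver v ν₁).inv ≫ Functor.whiskerRight (Lt.iota v ε) (Lt.forget v ⋙ Lt.toE v) ≫ (Lt.lamOver v ν₂).hom =
      𝟙 Lt.proj := by
  rw [whiskerRight_comp_lamOver_hom h, Iso.inv_hom_id]

/-- **Over `Th•[Z]` every `ι⊞_{v,ε}` is an isomorphism** (pre-log or post-log alike): its image under
`𝒩⊞_v → 𝒩_v → Th•[Z]` is a composite of structure isomorphisms.  In particular the add-on implies abc-iut-f-102's
per-place NECESSARY conditions for realising Cor 5.5 (i)+(iii) in one family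
(`isIso_toE_forget_iota_of_realisesCor55Families`, and its post-log variant).
[cite: MochizukiAbsTopIII2015, Def 5.4 (vii) p. 128] -/
theorem isIso_whiskerRight (h : Lt.IotaOver) (v : Vmod) {ν₁ ν₂ : LogVertex (isArc v)}
    (ε : LogEdgeLtimes (isArc v) ν₁ ν₂) : IsIso (Functor.whiskerRight (Lt.iota v ε) (Lt.forget v ⋙ Lt.toE v)) := by
  rw [h v ε]
  infer_instance

/-- Componentwise: each `(𝒩⊞_v → 𝒩_v → Th•[Z])(ι⊞_{v,ε,X₀})` is invertible. [cite: MochizukiAbsTopIII2015, Def 5.4 (vii) p. 128] -/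
theorem isIso_toE_forget_iota (h : Lt.IotaOver) (v : Vmod) {ν₁ ν₂ : LogVertex (isArc v)}
    (ε : LogEdgeLtimes (isArc v) ν₁ ν₂) (X₀ : Lt.X) :
    IsIso ((Lt.toE v).map ((Lt.forget v).map ((Lt.iota v ε).app X₀))) := by
  haveI := isIso_whiskerRight h v ε
  exact (inferInstance : IsIso ((Functor.whiskerRight (Lt.iota v ε) (Lt.forget v ⋙ Lt.toE v)).app X₀))

/-- Over `Th•[Z]` the `ι⊞_{v,ε}` depend only on the endpoints `ν₁, ν₂` of `ε`: two admissible edges with the same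
endpoints have the same image under `𝒩⊞_v → 𝒩_v → Th•[Z]` (both are the canonical identification of theaters).
[cite: MochizukiAbsTopIII2015, Def 5.4 (vii) p. 128] -/
theorem whiskerRight_eq_whiskerRight (h : Lt.IotaOver) (v : Vmod) {ν₁ ν₂ : LogVertex (isArc v)}
    (ε ε' : LogEdgeLtimes (isArc v) ν₁ ν₂) :
    Functor.whiskerRight (Lt.iota v ε) (Lt.forget v ⋙ Lt.toE v) =
      Functor.whiskerRight (Lt.iota v ε') (Lt.forget v ⋙ Lt.toE v) := by
  rw [h v ε, h v ε']

end IotaOver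

/-! ## The `TS`-valued `ι_{v,ε}` lie over `Th•[Z]` -/

namespace TSHomotopies

variable {Lt}

/-- **INTERFACE ADD-ON (Def 5.4 (iv)/(vii), `TS`-half): the `ι_{v,ε}` lie over `Th•[Z]`**, for EVERY edge `ε` of
`Γ⃗^log_v` (including, at nonarchimedean `v`, the edge "`↪ k`" of `Γ⃗^log_v ∖ Γ⃗^⋉_v` which carries no `ι⊞`): `ι_{v,ε}` pushed
down along `𝒩_v → Th•[Z]` is "`λ_{v,ν₁} ∘ Λ_{ν₁}` lies over" followed by "(`λ_{v,ν₂}` lies over)⁻¹" (associators inserted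
for the bracketing `(λ⊞ ⋙ forget) ⋙ toE` of the `TS` add-on).  A hypothesis schema on the pair `(L, T)`.
[cite: MochizukiAbsTopIII2015, Def 5.4 (vii) p. 128] -/
def IotaOverTS (T : Lt.TSHomotopies) : Prop :=
  ∀ (v : Vmod) ⦃ν₁ ν₂ : LogVertex (isArc v)⦄ (ε : LogEdgeTS (isArc v) ν₁ ν₂),
    Functor.whiskerRight (T.iota v ε) (Lt.toE v) =
      (Functor.associator _ _ _).hom ≫ (Lt.lamTwistOver v ν₁).hom ≫ (Lt.lamOver v ν₂).inv ≫
        (Functor.associator _ _ _).inv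

/-- Componentwise form of the `TS` clause. [cite: MochizukiAbsTopIII2015, Def 5.4 (vii) p. 128] -/
theorem IotaOverTS.app {T : Lt.TSHomotopies} (h : T.IotaOverTS) (v : Vmod) {ν₁ ν₂ : LogVertex (isArc v)}
    (ε : LogEdgeTS (isArc v) ν₁ ν₂) (X₀ : Lt.X) :
    (Lt.toE v).map ((T.iota v ε).app X₀) = (Lt.lamTwistOver v ν₁).hom.app X₀ ≫ (Lt.lamOver v ν₂).inv.app X₀ := by
  have := NatTrans.congr_app (h v ε) X₀
  simp only [Functor.whiskerRight_app, NatTrans.comp_app, Functor.associator_hom_app,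
    Functor.associator_inv_app] at this
  erw [Category.id_comp, Category.comp_id] at this
  exact this

/-- On the edges of `Γ⃗^⋉_v` the `TS`-valued `ι_{v,ε}` is `ι⊞_{v,ε}` pushed down to `𝒩_v` (`iota_toTS`), so there the `TS`
clause FOLLOWS from `IotaOver` (componentwise). [cite: MochizukiAbsTopIII2015, Def 5.4 (vii) p. 128] -/
theorem toE_map_iota_toTS (T : Lt.TSHomotopies) (h : Lt.IotaOver) (v : Vmod) {ν₁ ν₂ : LogVertex (isArc v)}
    (ε : LogEdgeLtimes (isArc v) ν₁ ν₂) (X₀ : Lt.X) :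
    (Lt.toE v).map ((T.iota v ε.toTS).app X₀) = (Lt.lamTwistOver v ν₁).hom.app X₀ ≫ (Lt.lamOver v ν₂).inv.app X₀ := by
  rw [T.iota_toTS v ε, Functor.whiskerRight_app]
  exact h.app v ε X₀

/-- Over `Th•[Z]` every `TS`-valued `ι_{v,ε}` is an isomorphism, given the `TS` add-on clause.
[cite: MochizukiAbsTopIII2015, Def 5.4 (vii) p. 128] -/
theorem IotaOverTS.isIso_toE_iota {T : Lt.TSHomotopies} (h : T.IotaOverTS) (v : Vmod)
    {ν₁ ν₂ : LogVertex (isArc v)} (ε : LogEdgeTS (isArc v) ν₁ ν₂) (X₀ : Lt.X) :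
    IsIso ((Lt.toE v).map ((T.iota v ε).app X₀)) := by
  have hI : IsIso (Functor.whiskerRight (T.iota v ε) (Lt.toE v)) := by
    rw [h v ε]
    infer_instance
  exact (inferInstance : IsIso ((Functor.whiskerRight (T.iota v ε) (Lt.toE v)).app X₀))

end TSHomotopies

/-! ## Non-vacuity: the diagonal setting -/


variable (Vmod isArc)

/-- **`IotaOver` is satisfiable over every index set**, in every universe: at the DIAGONAL setting on a category `C`
(every row `C`, every structure functor `𝟭 C`, every equivalence `Equivalence.refl`, every 2-cell a unitor /
identity, `ι⊞_{v,ε}` the unitor `Λ_{ν₁} ∘ 𝟭 ≅ 𝟭`) both sides of the schema are composites of unitors.  DEGENERATE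
consistency witness for the add-on's typing (no arithmetic content). [cite: MochizukiAbsTopIII2015, Def 5.4 (vii) p. 128] -/
theorem exists_iotaOver_of_category (C : Type (u + 1)) [Category.{u} C] :
    ∃ Lt : LogFrobeniusSettingLtimes Vmod isArc, Lt.X = C ∧ Lt.E = C ∧ (∀ v, Lt.Nplus v = C ∧ Lt.N v = C) ∧ Lt.IotaOver := by
  refine ⟨
    { X := C
      E := C
      proj := 𝟭 C
      log := 𝟭 C
      logIsoId := Iso.refl _
      logOver := Functor.leftUnitor (𝟭 C)
      Nplus := fun _ => C
      N := fun _ => C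
      forget := fun _ => 𝟭 C
      toE := fun _ => 𝟭 C
      lam := fun _ _ => 𝟭 C
      lamOver := fun _ _ => Functor.isoWhiskerLeft (𝟭 C) (Functor.leftUnitor (𝟭 C)) ≪≫ Functor.leftUnitor (𝟭 C)
      lam_spaceLink_eq_postLog := fun _ => rfl
      iota := fun _ ν₁ _ _ => (diagonalTwistIso ν₁.isPostLog).hom
      An := C
      κAn := CategoryTheory.Equivalence.refl
      φAn := 𝟭 C
      φAn_isEquivalence := inferInstance
      ηAn := Iso.refl _
      κAn₂ := CategoryTheory.Equivalence.refl
      Emono := C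
      monoAn := 𝟭 C
      NmonoPlus := fun _ => C
      Nmono := fun _ => C
      forgetMono := fun _ => 𝟭 C
      toEmono := fun _ => 𝟭 C
      monoNplus := fun _ => 𝟭 C
      monoN := fun _ => 𝟭 C
      monoHomotopy := fun _ => Iso.refl _
      AnMono := C
      κAnMono := CategoryTheory.Equivalence.refl
      ψAnMono := fun _ _ => 𝟭 C }, rfl, rfl, fun _ => ⟨rfl, rfl⟩, ?_⟩
  intro v ν₁ ν₂ ε
  dsimp only [lamTwistOver]
  generalize ν₁.isPostLog = b
  cases b <;> ext X₀ <;> dsimp [twistOver, diagonalTwistIso] <;>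
    simp only [Functor.whiskerRight_app, Functor.id_obj, Functor.leftUnitor_hom_app, Functor.comp_map,
      Functor.id_map, Functor.isoWhiskerLeft_twice, Iso.trans_assoc, Iso.self_symm_id_assoc, Iso.trans_hom,
      Functor.isoWhiskerLeft_hom, NatTrans.comp_app, Functor.whiskerLeft_app, Functor.associator_hom_app,
      Iso.trans_inv, Functor.isoWhiskerLeft_inv, Functor.leftUnitor_inv_app, Category.assoc] <;>
    (repeat erw [Category.id_comp])

end LogFrobeniusSettingLtimes

end Literature.AnabelianGeometry.AbsoluteAnabelian
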